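import Mathlib

/-!
# Crux K2 `PoloidalWindowRigidity` (stmt-NavierStokesRegularity-19708), line `z_shock` — R3 inhabitant census (XI): CUBIC SLICES WITH A
# PAIR OF CRITICAL POINTS are rigid at ONE height — the structure function is constant along the slice (`γ' = 0` on a value interval)

`--supports stmt-NavierStokesRegularity-19708 --as helper` (leafhand-ns-poloidalwindowdoor-3 g22, cell decomp-ns, 2026-09-01).  Class-free,
def-free, Mathlib only; companion of part X (`…ZShockTurningShearMonotone`, same hand).  **No stub and no summit is closed by this file;
Navier–Stokes regularity is NOT proved here (rung 0).**

Part X showed that the census item «cubic / higher polynomial slices» queued by hand 3-g21 has a NEGATIVE answer for MONOTONE cubics: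
the polynomial slice `(t − cs)³ + 3(t − cs)` inhabits a uniformly hyperbolic, strictly genuinely nonlinear column at every height.  This
file gives the complementary POSITIVE half of the degree-three census in one horizontal dimension (planar patterns `W(s,y) = w(s,y₀)` of
the 2-D equation, `ΔW = ∂²w`, `|∇W|² = (∂w)²`): a cubic slice whose derivative has TWO DISTINCT REAL ZEROS — normal form
`W(t) = c₃t³ − 3c₃r²t + c₀`, `c₃ ≠ 0`, `r ≠ 0`, after translating `t` (the single-height identity is translation invariant) — is rigid
already at ONE height, for ANY differentiable structure function `γ` and ANY cubic right-hand side `ℓ` (at all heights `ℓ = ∂ₛ∂ₛW` is a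
cubic in `t`):

  `ℓ(t) = γ(W(t))·W''(t) + γ'(W(t))·W'(t)²` for all `t`  ⟹  `γ` is CONSTANT on the slice and `γ' = 0` on a nontrivial value interval.

MECHANISM (new in the series; neither the explicit value curves of parts III–VIII nor the ODE blow-up of parts I–II): the identity is
`(γ(W)·W')' = ℓ`, so `γ(W(t))·W'(t) = Λ(t)` is a QUARTIC polynomial.  A cubic with two critical points is three-to-one on its middle range:
`W(m + d) = W(m − d)` whenever `d² = 3(r² − m²)`, an ELLIPSE of pairs.  Equal values of `W` carry equal values of `γ∘W`, so
`Λ(m+d)·W'(m−d) = Λ(m−d)·W'(m+d)` on the ellipse; dividing by `d` this is a quintic polynomial identity in `m` on `(−|r|, |r|)`, hence an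
identity of polynomials (`Polynomial.eq_zero_of_infinite_isRoot`), whose coefficients force `Λ = (l₁/2)(t² − r²) ∝ W'` — i.e. `γ∘W` constant.
(For a MONOTONE cubic the ellipse has no real points and part X's inhabitants appear; for the degenerate double critical point `r = 0` the
fibres are single and the argument is different — not treated here.)

* ★ `cubicSlice_twoCritical_rigid` — the statement above, with conclusions (i) `∃ κ, γ(W(t)) = κ` for all `t`; (ii) `γ'(W(t)) = 0` for all
  `t`; (iii) `∃ p < q, γ' = 0 on (p, q)` (the negation of the strictness clause `hstrict` of part IX `…Synthesis`).
* `cubicSlice_twoCritical_not_strictGN` — corollary: no such slice solves the single-height identity on a STRICTLY genuinely nonlinear column.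

Honest scope: toy census, kinematic, single height, one horizontal dimension (planar 2-D patterns); unbounded patterns, so nothing here
bears on `hGN` (XL, not in print).  Together with part X the degree-three census in 1-D reads: monotone ⇒ inhabited (unbounded travelling
members); two critical points ⇒ rigid at one height; double critical point ⇒ open here (expected rigid via differentiability of `γ` at the
critical value).  presearch: functional equation `Γ∘(cubic) = quintic` / polynomial right-composition factors — elementary [folklore];
nothing in `Theorems/…ZShock*` (rg «cubic slice|three-to-one|ellipse of pairs»: 0 hits). [folklore]
-/

noncomputable section

namespace Summit.NavierStokesRegularity.NavierStokesRegularity.Theorems.PoloidalWindowDoorPoloidalWindowRigidityZShockTurningShearCubic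

-- the summit and its single sub-problem share the name (CONVENTIONS §1)
set_option linter.dupNamespace false

open Set Filter Topology

/-- ★ **Cubic slices with two critical points are rigid at one height.**  Let `γ` be differentiable on `ℝ` with derivative `γ'`, let
`c₃ ≠ 0`, `r ≠ 0`, `c₀, l₀, l₁, l₂, l₃ ∈ ℝ`, and suppose the cubic slice `W(t) = c₃t³ − 3c₃r²t + c₀` (critical points `±r`) satisfies the
single-height identity of the autonomous height-evolution with a cubic right-hand side,
`l₀ + l₁t + l₂t² + l₃t³ = γ(W t)·W''(t) + γ'(W t)·W'(t)²` for all `t` (`W' = 3c₃t² − 3c₃r²`, `W'' = 6c₃t`).  Then (i) `γ∘W` is constant,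
(ii) `γ'∘W ≡ 0`, and (iii) `γ'` vanishes on a nontrivial open interval of values. [folklore] -/
theorem cubicSlice_twoCritical_rigid {γ γ' : ℝ → ℝ} (hγ : ∀ u, HasDerivAt γ (γ' u) u)
    {c₃ c₀ r l₀ l₁ l₂ l₃ : ℝ} (hc₃ : c₃ ≠ 0) (hr : r ≠ 0)
    (hpde : ∀ t : ℝ, l₀ + l₁ * t + l₂ * t ^ 2 + l₃ * t ^ 3 =
      γ (c₃ * t ^ 3 - 3 * c₃ * r ^ 2 * t + c₀) * (6 * c₃ * t) +
        γ' (c₃ * t ^ 3 - 3 * c₃ * r ^ 2 * t + c₀) * (3 * c₃ * t ^ 2 - 3 * c₃ * r ^ 2) ^ 2) :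
    (∃ κ, ∀ t, γ (c₃ * t ^ 3 - 3 * c₃ * r ^ 2 * t + c₀) = κ) ∧
    (∀ t, γ' (c₃ * t ^ 3 - 3 * c₃ * r ^ 2 * t + c₀) = 0) ∧
    (∃ p q : ℝ, p < q ∧ ∀ u, p < u → u < q → γ' u = 0) := by
  -- derivatives of the slice
  have hWd : ∀ t, HasDerivAt (fun t : ℝ => c₃ * t ^ 3 - 3 * c₃ * r ^ 2 * t + c₀) (3 * c₃ * t ^ 2 - 3 * c₃ * r ^ 2) t := by
    intro t
    have := ((((hasDerivAt_id' t).pow 3).const_mul c₃).sub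
      ((hasDerivAt_id' t).const_mul (3 * c₃ * r ^ 2))).add_const c₀
    exact this.congr_deriv (by push_cast; ring)
  have hWc : Continuous (fun t : ℝ => c₃ * t ^ 3 - 3 * c₃ * r ^ 2 * t + c₀) :=
    continuous_iff_continuousAt.2 fun t => (hWd t).continuousAt
  -- (1) `h = γ(W)·W'` has derivative `ℓ`
  have hh : ∀ t, HasDerivAt (fun t => γ ((c₃ * t ^ 3 - 3 * c₃ * r ^ 2 * t + c₀)) * (3 * c₃ * t ^ 2 - 3 * c₃ * r ^ 2))
      (l₀ + l₁ * t + l₂ * t ^ 2 + l₃ * t ^ 3) t := by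
    intro t
    have h1 : HasDerivAt (fun t => γ ((c₃ * t ^ 3 - 3 * c₃ * r ^ 2 * t + c₀))) (γ' ((c₃ * t ^ 3 - 3 * c₃ * r ^ 2 * t + c₀)) * (3 * c₃ * t ^ 2 - 3 * c₃ * r ^ 2)) t :=
      (hγ ((c₃ * t ^ 3 - 3 * c₃ * r ^ 2 * t + c₀))).comp t (hWd t)
    have h2 : HasDerivAt (fun t : ℝ => 3 * c₃ * t ^ 2 - 3 * c₃ * r ^ 2) (6 * c₃ * t) t := by
      have := (((hasDerivAt_id' t).pow 2).const_mul (3 * c₃)).sub_const (3 * c₃ * r ^ 2)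
      exact this.congr_deriv (by push_cast; ring)
    refine (h1.mul h2).congr_deriv ?_
    have := hpde t
    linear_combination -this
  -- (2) the quartic antiderivative `Λ` of `ℓ`, and `h = Λ + κ`
  have hΛ : ∀ t, HasDerivAt (fun t : ℝ => l₀ * t + l₁ / 2 * t ^ 2 + l₂ / 3 * t ^ 3 + l₃ / 4 * t ^ 4)
      (l₀ + l₁ * t + l₂ * t ^ 2 + l₃ * t ^ 3) t := by
    intro t
    have := ((((hasDerivAt_id' t).const_mul l₀).add (((hasDerivAt_id' t).pow 2).const_mul (l₁ / 2))).add
      (((hasDerivAt_id' t).pow 3).const_mul (l₂ / 3))).add (((hasDerivAt_id' t).pow 4).const_mul (l₃ / 4))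
    exact this.congr_deriv (by push_cast; ring)
  obtain ⟨κ, hκ⟩ : ∃ κ, ∀ t, γ ((c₃ * t ^ 3 - 3 * c₃ * r ^ 2 * t + c₀)) * (3 * c₃ * t ^ 2 - 3 * c₃ * r ^ 2) =
      κ + l₀ * t + l₁ / 2 * t ^ 2 + l₂ / 3 * t ^ 3 + l₃ / 4 * t ^ 4 := by
    have hD : ∀ t, HasDerivAt (fun t => γ ((c₃ * t ^ 3 - 3 * c₃ * r ^ 2 * t + c₀)) * (3 * c₃ * t ^ 2 - 3 * c₃ * r ^ 2) -
        (l₀ * t + l₁ / 2 * t ^ 2 + l₂ / 3 * t ^ 3 + l₃ / 4 * t ^ 4)) 0 t := fun t =>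
      ((hh t).sub (hΛ t)).congr_deriv (by ring)
    have hc := is_const_of_deriv_eq_zero (fun t => (hD t).differentiableAt) (fun t => (hD t).deriv)
    refine ⟨γ ((c₃ * 0 ^ 3 - 3 * c₃ * r ^ 2 * 0 + c₀)) * (3 * c₃ * (0 : ℝ) ^ 2 - 3 * c₃ * r ^ 2) -
      (l₀ * 0 + l₁ / 2 * (0 : ℝ) ^ 2 + l₂ / 3 * (0 : ℝ) ^ 3 + l₃ / 4 * (0 : ℝ) ^ 4), fun t => ?_⟩
    have := hc t 0
    linarith
  -- (3) the ellipse of equal values: `W(m+d) = W(m-d)` when `d² = 3(r² − m²)`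
  have hQ : ∀ m : ℝ, -|r| < m → m < |r| →
      48 * l₃ * m ^ 5 + 32 * l₂ * m ^ 4 - 60 * r ^ 2 * l₃ * m ^ 3 - (24 * l₀ + 48 * r ^ 2 * l₂) * m ^ 2 +
        (-12 * κ - 6 * r ^ 2 * l₁ + 9 * r ^ 4 * l₃) * m + (12 * r ^ 2 * l₀ + 12 * r ^ 4 * l₂) = 0 := by
    intro m hm1 hm2
    have hm : m ^ 2 < r ^ 2 := by
      have : |m| < |r| := abs_lt.2 ⟨hm1, hm2⟩
      exact sq_lt_sq.2 this
    have h3 : 0 < 3 * (r ^ 2 - m ^ 2) := by linarith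
    set d : ℝ := √(3 * (r ^ 2 - m ^ 2)) with hd_def
    have hdpos : 0 < d := Real.sqrt_pos.2 h3
    have hd : d ^ 2 = 3 * (r ^ 2 - m ^ 2) := Real.sq_sqrt h3.le
    -- equal values
    have hWeq : (c₃ * (m + d) ^ 3 - 3 * c₃ * r ^ 2 * (m + d) + c₀) = (c₃ * (m - d) ^ 3 - 3 * c₃ * r ^ 2 * (m - d) + c₀) := by
      linear_combination (2 * c₃ * d) * hd
    have hγeq : γ ((c₃ * (m + d) ^ 3 - 3 * c₃ * r ^ 2 * (m + d) + c₀)) = γ ((c₃ * (m - d) ^ 3 - 3 * c₃ * r ^ 2 * (m - d) + c₀)) := by rw [hWeq]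
    have e1 := hκ (m + d)
    have e2 := hκ (m - d)
    rw [hγeq] at e1
    -- `Λκ(m+d)·W'(m−d) = Λκ(m−d)·W'(m+d)`
    have hΔ : (κ + l₀ * (m + d) + l₁ / 2 * (m + d) ^ 2 + l₂ / 3 * (m + d) ^ 3 + l₃ / 4 * (m + d) ^ 4) *
          ((m - d) ^ 2 - r ^ 2) -
        (κ + l₀ * (m - d) + l₁ / 2 * (m - d) ^ 2 + l₂ / 3 * (m - d) ^ 3 + l₃ / 4 * (m - d) ^ 4) *
          ((m + d) ^ 2 - r ^ 2) = 0 := by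
      linear_combination (-((m - d) ^ 2 - r ^ 2)) * e1 + ((m + d) ^ 2 - r ^ 2) * e2
    -- reduce modulo `d² = 3(r² − m²)`: `3Δ = d · Q₃(m)`
    have hΔ' : 3 * ((κ + l₀ * (m + d) + l₁ / 2 * (m + d) ^ 2 + l₂ / 3 * (m + d) ^ 3 + l₃ / 4 * (m + d) ^ 4) *
          ((m - d) ^ 2 - r ^ 2) -
        (κ + l₀ * (m - d) + l₁ / 2 * (m - d) ^ 2 + l₂ / 3 * (m - d) ^ 3 + l₃ / 4 * (m - d) ^ 4) *
          ((m + d) ^ 2 - r ^ 2)) =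
        d * (48 * l₃ * m ^ 5 + 32 * l₂ * m ^ 4 - 60 * r ^ 2 * l₃ * m ^ 3 - (24 * l₀ + 48 * r ^ 2 * l₂) * m ^ 2 +
          (-12 * κ - 6 * r ^ 2 * l₁ + 9 * r ^ 4 * l₃) * m + (12 * r ^ 2 * l₀ + 12 * r ^ 4 * l₂)) := by
      linear_combination (6 * d * l₀ + 4 * d * r ^ 2 * l₂ + 2 * d ^ 3 * l₂ + 3 * m * d * r ^ 2 * l₃ +
        3 * m * d ^ 3 * l₃ - 10 * m ^ 2 * d * l₂ - 15 * m ^ 3 * d * l₃) * hd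
    rw [hΔ, mul_zero] at hΔ'
    have := mul_eq_zero.1 hΔ'.symm
    exact this.resolve_left hdpos.ne'
  -- (4) the quintic vanishes on `(−|r|, |r|)`, hence identically: all `m`
  have habs : -|r| < |r| := by
    have : 0 < |r| := abs_pos.2 hr
    linarith
  have heval : ∀ m : ℝ, (Polynomial.C (48 * l₃) * Polynomial.X ^ 5 + Polynomial.C (32 * l₂) * Polynomial.X ^ 4 -
      Polynomial.C (60 * r ^ 2 * l₃) * Polynomial.X ^ 3 - Polynomial.C (24 * l₀ + 48 * r ^ 2 * l₂) * Polynomial.X ^ 2 +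
      Polynomial.C (-12 * κ - 6 * r ^ 2 * l₁ + 9 * r ^ 4 * l₃) * Polynomial.X +
      Polynomial.C (12 * r ^ 2 * l₀ + 12 * r ^ 4 * l₂) : Polynomial ℝ).eval m =
      48 * l₃ * m ^ 5 + 32 * l₂ * m ^ 4 - 60 * r ^ 2 * l₃ * m ^ 3 - (24 * l₀ + 48 * r ^ 2 * l₂) * m ^ 2 +
        (-12 * κ - 6 * r ^ 2 * l₁ + 9 * r ^ 4 * l₃) * m + (12 * r ^ 2 * l₀ + 12 * r ^ 4 * l₂) := by
    intro m
    simp only [Polynomial.eval_add, Polynomial.eval_sub, Polynomial.eval_mul, Polynomial.eval_C,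
      Polynomial.eval_pow, Polynomial.eval_X]
  have hP0 : (Polynomial.C (48 * l₃) * Polynomial.X ^ 5 + Polynomial.C (32 * l₂) * Polynomial.X ^ 4 -
      Polynomial.C (60 * r ^ 2 * l₃) * Polynomial.X ^ 3 - Polynomial.C (24 * l₀ + 48 * r ^ 2 * l₂) * Polynomial.X ^ 2 +
      Polynomial.C (-12 * κ - 6 * r ^ 2 * l₁ + 9 * r ^ 4 * l₃) * Polynomial.X +
      Polynomial.C (12 * r ^ 2 * l₀ + 12 * r ^ 4 * l₂) : Polynomial ℝ) = 0 := by
    refine Polynomial.eq_zero_of_infinite_isRoot _ ((Set.Ioo_infinite habs).mono ?_)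
    intro m hm
    show Polynomial.eval m _ = 0
    rw [heval]
    exact hQ m hm.1 hm.2
  have hQall : ∀ m : ℝ,
      48 * l₃ * m ^ 5 + 32 * l₂ * m ^ 4 - 60 * r ^ 2 * l₃ * m ^ 3 - (24 * l₀ + 48 * r ^ 2 * l₂) * m ^ 2 +
        (-12 * κ - 6 * r ^ 2 * l₁ + 9 * r ^ 4 * l₃) * m + (12 * r ^ 2 * l₀ + 12 * r ^ 4 * l₂) = 0 := by
    intro m
    have h := heval m
    rw [hP0, Polynomial.eval_zero] at h
    exact h.symm
  -- (5) read off the coefficients: `l₀ = l₂ = l₃ = 0`, `κ = −r² l₁ / 2`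
  have e0 := hQall 0
  have e1 := hQall r
  have e2 := hQall (-r)
  have e3 := hQall (2 * r)
  have e4 := hQall (-2 * r)
  have hr2 : r ^ 2 ≠ 0 := pow_ne_zero 2 hr
  have hr4 : r ^ 4 ≠ 0 := pow_ne_zero 4 hr
  have hr5 : r ^ 5 ≠ 0 := pow_ne_zero 5 hr
  have hl₂ : l₂ = 0 := by
    have h : l₂ * r ^ 4 = 0 := by linear_combination ((e1 + e2) / 2 + e0) / 8
    exact (mul_eq_zero.1 h).resolve_right hr4
  have hl₀ : l₀ = 0 := by
    have h : l₀ * r ^ 2 = 0 := by linear_combination e0 / 12 - r ^ 4 * hl₂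
    exact (mul_eq_zero.1 h).resolve_right hr2
  have hl₃ : l₃ = 0 := by
    have h : l₃ * r ^ 5 = 0 := by linear_combination ((e3 - e4) / 4 - (e1 - e2) / 2) / 540
    exact (mul_eq_zero.1 h).resolve_right hr5
  have hκ' : κ = -(r ^ 2 * l₁) / 2 := by
    have h : r * (12 * κ + 6 * r ^ 2 * l₁) = 0 := by
      linear_combination -(e1 - e2) / 2 - 3 * r ^ 5 * hl₃
    have h' := (mul_eq_zero.1 h).resolve_left hr
    linarith
  -- (6) `γ∘W` is constant off the critical points, and at them via the companion preimages `∓2r`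
  have hval : ∀ t, t ^ 2 ≠ r ^ 2 → γ ((c₃ * t ^ 3 - 3 * c₃ * r ^ 2 * t + c₀)) = l₁ / (6 * c₃) := by
    intro t ht
    have e := hκ t
    rw [hl₀, hl₂, hl₃, hκ'] at e
    have h : (γ ((c₃ * t ^ 3 - 3 * c₃ * r ^ 2 * t + c₀)) * (6 * c₃) - l₁) * (t ^ 2 - r ^ 2) = 0 := by linear_combination 2 * e
    have h' := (mul_eq_zero.1 h).resolve_right (sub_ne_zero.2 ht)
    rw [eq_div_iff (mul_ne_zero (by norm_num) hc₃)]
    linarith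
  have h4r : (2 * r) ^ 2 ≠ r ^ 2 := by
    intro h
    apply hr
    nlinarith [h]
  have h4r' : (-2 * r) ^ 2 ≠ r ^ 2 := by
    intro h
    apply hr
    nlinarith [h]
  have hWr : (c₃ * r ^ 3 - 3 * c₃ * r ^ 2 * r + c₀) = (c₃ * (-2 * r) ^ 3 - 3 * c₃ * r ^ 2 * (-2 * r) + c₀) := by ring
  have hWr' : (c₃ * (-r) ^ 3 - 3 * c₃ * r ^ 2 * (-r) + c₀) = (c₃ * (2 * r) ^ 3 - 3 * c₃ * r ^ 2 * (2 * r) + c₀) := by ring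
  have hconst : ∀ t, γ ((c₃ * t ^ 3 - 3 * c₃ * r ^ 2 * t + c₀)) = l₁ / (6 * c₃) := by
    intro t
    by_cases ht : t ^ 2 = r ^ 2
    · rcases sq_eq_sq_iff_eq_or_eq_neg.1 ht with h | h
      · rw [h, hWr]; exact hval _ h4r'
      · rw [h, hWr']; exact hval _ h4r
    · exact hval t ht
  -- (7) `γ'∘W ≡ 0`: differentiate the constant `γ∘W`
  have hder : ∀ t, γ' ((c₃ * t ^ 3 - 3 * c₃ * r ^ 2 * t + c₀)) * (3 * c₃ * t ^ 2 - 3 * c₃ * r ^ 2) = 0 := by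
    intro t
    have h1 : HasDerivAt (fun t => γ ((c₃ * t ^ 3 - 3 * c₃ * r ^ 2 * t + c₀))) (γ' ((c₃ * t ^ 3 - 3 * c₃ * r ^ 2 * t + c₀)) * (3 * c₃ * t ^ 2 - 3 * c₃ * r ^ 2)) t :=
      (hγ ((c₃ * t ^ 3 - 3 * c₃ * r ^ 2 * t + c₀))).comp t (hWd t)
    have h2 : HasDerivAt (fun t => γ ((c₃ * t ^ 3 - 3 * c₃ * r ^ 2 * t + c₀))) 0 t := by
      have : (fun t => γ ((c₃ * t ^ 3 - 3 * c₃ * r ^ 2 * t + c₀))) = fun _ => l₁ / (6 * c₃) := funext hconst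
      rw [this]
      exact hasDerivAt_const t _
    exact h1.unique h2
  have hder' : ∀ t, t ^ 2 ≠ r ^ 2 → γ' ((c₃ * t ^ 3 - 3 * c₃ * r ^ 2 * t + c₀)) = 0 := by
    intro t ht
    have h := hder t
    have hne : 3 * c₃ * t ^ 2 - 3 * c₃ * r ^ 2 ≠ 0 := by
      have : 3 * c₃ * t ^ 2 - 3 * c₃ * r ^ 2 = 3 * c₃ * (t ^ 2 - r ^ 2) := by ring
      rw [this]
      exact mul_ne_zero (mul_ne_zero (by norm_num) hc₃) (sub_ne_zero.2 ht)
    exact (mul_eq_zero.1 h).resolve_right hne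
  have hderall : ∀ t, γ' ((c₃ * t ^ 3 - 3 * c₃ * r ^ 2 * t + c₀)) = 0 := by
    intro t
    by_cases ht : t ^ 2 = r ^ 2
    · rcases sq_eq_sq_iff_eq_or_eq_neg.1 ht with h | h
      · rw [h, hWr]; exact hder' _ h4r'
      · rw [h, hWr']; exact hder' _ h4r
    · exact hder' t ht
  -- (8) a nontrivial interval of values: `(c₃ * 0 ^ 3 - 3 * c₃ * r ^ 2 * 0 + c₀) ≠ (c₃ * r ^ 3 - 3 * c₃ * r ^ 2 * r + c₀)`
  have hne0 : (c₃ * (0:ℝ) ^ 3 - 3 * c₃ * r ^ 2 * 0 + c₀) ≠ (c₃ * r ^ 3 - 3 * c₃ * r ^ 2 * r + c₀) := by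
    intro h
    have : 2 * c₃ * r ^ 3 = 0 := by linear_combination h
    have : c₃ * r ^ 3 ≠ 0 := mul_ne_zero hc₃ (pow_ne_zero 3 hr)
    exact this (by linarith)
  refine ⟨⟨l₁ / (6 * c₃), hconst⟩, hderall, min ((c₃ * 0 ^ 3 - 3 * c₃ * r ^ 2 * 0 + c₀)) ((c₃ * r ^ 3 - 3 * c₃ * r ^ 2 * r + c₀)), max ((c₃ * 0 ^ 3 - 3 * c₃ * r ^ 2 * 0 + c₀)) ((c₃ * r ^ 3 - 3 * c₃ * r ^ 2 * r + c₀)), min_lt_max.2 hne0, ?_⟩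
  intro u hpu huq
  have hu : u ∈ uIcc ((c₃ * 0 ^ 3 - 3 * c₃ * r ^ 2 * 0 + c₀)) ((c₃ * r ^ 3 - 3 * c₃ * r ^ 2 * r + c₀)) := by
    rw [uIcc, mem_Icc]
    exact ⟨hpu.le, huq.le⟩
  obtain ⟨t, -, ht⟩ := intermediate_value_uIcc hWc.continuousOn hu
  rw [← ht]
  exact hderall t

/-- **Corollary: no cubic slice with two critical points on a STRICTLY genuinely nonlinear column.**  With the data of
`cubicSlice_twoCritical_rigid`, the strictness clause of part IX (`γ'` constant on no nontrivial interval) is violated. [folklore] -/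
theorem cubicSlice_twoCritical_not_strictGN {γ γ' : ℝ → ℝ} (hγ : ∀ u, HasDerivAt γ (γ' u) u)
    (hstrict : ∀ p q k : ℝ, p < q → ∃ t, p < t ∧ t < q ∧ γ' t ≠ k)
    {c₃ c₀ r l₀ l₁ l₂ l₃ : ℝ} (hc₃ : c₃ ≠ 0) (hr : r ≠ 0)
    (hpde : ∀ t : ℝ, l₀ + l₁ * t + l₂ * t ^ 2 + l₃ * t ^ 3 =
      γ (c₃ * t ^ 3 - 3 * c₃ * r ^ 2 * t + c₀) * (6 * c₃ * t) +
        γ' (c₃ * t ^ 3 - 3 * c₃ * r ^ 2 * t + c₀) * (3 * c₃ * t ^ 2 - 3 * c₃ * r ^ 2) ^ 2) :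
    False := by
  obtain ⟨-, -, p, q, hpq, h0⟩ := cubicSlice_twoCritical_rigid hγ hc₃ hr hpde
  obtain ⟨t, hpt, htq, hγt⟩ := hstrict p q 0 hpq
  exact hγt (h0 t hpt htq)

end Summit.NavierStokesRegularity.NavierStokesRegularity.Theorems.PoloidalWindowDoorPoloidalWindowRigidityZShockTurningShearCubic

end
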